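import Literature.NumberTheory.LFunctions.NymanBeurling
import Literature.NumberTheory.LFunctions.QuasiRHFactsProofs
import Literature.Analysis.Complex.RectangleCauchyFormula
import HarnessLib

/-!
# Báez-Duarte's Lemma 2.1 (Balazard–Saias, *Notes sur la fonction ζ de Riemann, 1*, Lemme 2)

Topic: `Literature/NumberTheory/LFunctions`. Discharge of the named fact
`Literature.NumberTheory.LFunctions.baezDuarte_moebiusSum_approx` (`NymanBeurling.lean`;
L. Báez-Duarte, *A strengthening of the Nyman–Beurling criterion for the Riemann hypothesis*,
Rend. Lincei (9) Mat. Appl. 14 (2003), 5–11, Lemma 2.1, quoting M. Balazard, E. Saias,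
*Notes sur la fonction ζ de Riemann, 1*, Adv. Math. 139 (1998), 310–321, Lemme 2, p. 315):
if `1/2 ≤ α < 1`, `δ > 0`, `ε > 0` and `ζ(s) ≠ 0` on `Re s > α`, then for `n ≥ 2` and
`α + δ ≤ Re s ≤ 1` (`s = σ + iτ`, `s ≠ 1`)

  `∑_{a ≤ n} μ(a) a^{-s} = 1/ζ(s) + O_{α,δ,ε}(n^{-δ/3} (1 + |τ|)^ε)`.

## The proof

The printed proof (Balazard–Saias, pp. 315–316) applies the effective (truncated) Perron formula
to the Dirichlet series `1/ζ(s+w) = ∑ μ(m) m^{-s} m^{-w}` on `[κ−iT, κ+iT]`, moves the segment to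
`Re w = κ' = α − σ + δ/2`, picks up the residue `1/ζ(s)` of `ζ(s+w)^{-1} x^w/w` at `w = 0`, bounds
the three remaining integrals by their Lemme 1 (`|ζ(s)|^{-1} ≤ c|τ|^ε` for `σ ≥ α + δ`, the
quasi-RH form of Titchmarsh's Thm. 14.2) and takes `T = x^B`. We run the same contour shift with
the smoothed Perron kernel of `MertensBoundRH.lean` in place of the truncation, so that every
integral is absolutely convergent (as in the tree's `MoebiusRieszPerron.lean`, which treats Riesz
means on the line `Re s = 1/2 + δ` under RH):

* `integral_vertical_two_eq_tsum_shift` — the smoothed Perron formula on `Re w = 2` for the shifted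
  series: `∫ Φ_h(2+it) x^{2+it} ζ(s+2+it)^{-1} dt = 2π ∑ μ(m) m^{-s} φ_h(m/x)`, where
  `φ_h = 𝟙_{[0,1]}` continued linearly to `0` on `[1, 1+h]` and `Φ_h = mellin φ_h`
  (`MertensBoundRH.phi`, `MertensBoundRH.Phi`, `MertensBoundRH.mellinInv_Phi`).
* `integral_vertical_sub_eq_of_tendsto` — shifting a vertical line of integration of `f(w)/w`
  past the simple pole at `w = 0`: `∫_{Re w = b} − ∫_{Re w = a} = 2π f(0)` (`a < 0 < b`), from the
  tree's Cauchy integral formula for rectangles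
  (`Literature.Analysis.Complex.integral_boundary_rect_div_sub_eq`) and `T → ∞`.
* `Φ_h(w) = Ψ_h(w)/w` with `Ψ_h(w) = ((1+h)^{w+1} − 1)/(h(w+1))` entire away from `w = -1`,
  `Ψ_h(0) = 1`, and the pole-free integrand `f(w) = Ψ_h(w) x^w ζinv(s+w)` (both written out; the
  file declares no definitions) (`ζinv = 1/ζ` with the removable singularity at
  `1` filled in, `MertensBoundRH.zetaInv`, holomorphic on `Re > α` under quasi-RH(`α`),
  `MertensBoundQuasiRH.differentiableOn_zetaInv`), so that `f(0) = ζinv(s)`; bounds for `Ψ_h`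
  (`‖Ψ_h‖ ≤ 8`, `‖Ψ_h(w)‖ ≤ 9/(h‖w+1‖)`, interpolation) and for `f(w)/w` on the lines `Re w = 2`,
  `Re w = -η'` (`0 < η' ≤ 1/2`) and on horizontal segments, from Lemme 1 in the uniform form
  `‖ζinv(σ'+it')‖ ≤ K(1+|t'|)^{ε₁}` on `σ' ≥ α + δ/2` (PROVED in the tree:
  `MertensBoundQuasiRH.exists_bound_zetaInv`, from `QuasiRHInvZetaBound.lean`, Borel–Carathéodory
  and Hadamard's three circles as in Titchmarsh §14.2).
* `norm_tsum_phi_sub_zetaInv_le` — the key estimate: for `α + δ ≤ Re s ≤ 1`, `x ≥ 1`,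
  `0 < h ≤ 1`, `‖∑ μ(m) m^{-s} φ_h(m/x) − ζinv(s)‖ ≤ (1/2π)(36K/η') h^{-2ε₁} x^{-η'} (1+|τ|)^{ε₁} J`
  with `η' = Re s − α − δ/2` (the new line is `Re(s+w) = α + δ/2`) and `J = ∫ (1+|t|)^{-1-ε₁} dt`.
* `norm_tsum_phi_sub_sum_le` — removing the smoothing costs at most `nh · n^{-Re s}` (the two sums
  differ in the `≤ nh` terms `n < m ≤ n(1+h)`).
* `baezDuarte_moebiusSum_approx_holds` — with `h = n^{-(1/2 − 2δ/3)}` and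
  `ε₁ = min(ε, δ/6, 1/4)` both errors are `≤ C n^{-δ/3} (1+|τ|)^ε` (using `α ≥ 1/2`; for
  `α + δ > 1` the statement is vacuous), which is the printed exponent `δ/3`.

## References

* L. Báez-Duarte, *A strengthening of the Nyman–Beurling criterion for the Riemann hypothesis*,
  Atti Accad. Naz. Lincei Rend. Lincei (9) Mat. Appl. 14 (2003), 5–11 (arXiv:math/0202141),
  Lemma 2.1.
* M. Balazard, E. Saias, *Notes sur la fonction ζ de Riemann, 1*, Adv. Math. 139 (1998),
  310–321, Lemme 1 and Lemme 2 (p. 315) and the proof of Lemme 2 (pp. 315–316).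
* E. C. Titchmarsh, *The Theory of the Riemann Zeta-Function*, 2nd ed. (1986), §3.12 (Perron's
  formula), Thm. 14.2 and (14.2.6), Thm. 14.25 (A).
-/

noncomputable section

open Complex Filter Topology Asymptotics MeasureTheory Set
open scoped Real

namespace Literature.NumberTheory.LFunctions

namespace MoebiusSumApprox

open MertensBoundRH

/-! ### A line shift past a simple pole at `w = 0` -/

/-- **Shifting a vertical line of integration past a simple pole at `0`.** If `f` is holomorphic
on the closed strip `a ≤ Re w ≤ b` with `a < 0 < b`, `f(w)/w` is integrable on both boundary
lines and `f(σ+iT)/(σ+iT) → 0` as `|T| → ∞` uniformly in `σ ∈ [a, b]`, then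
`∫ f(b+it)/(b+it) dt − ∫ f(a+it)/(a+it) dt = 2π f(0)` (Cauchy's integral formula on the
rectangles `[a,b] × [-T,T]`, `T → ∞`). [folklore] -/
theorem integral_vertical_sub_eq_of_tendsto (f : ℂ → ℂ) {a b : ℝ} (ha : a < 0) (hb : 0 < b)
    (hfd : DifferentiableOn ℂ f (Icc a b ×ℂ univ))
    (hFa : Integrable fun t : ℝ => f (a + t * I) / (a + t * I))
    (hFb : Integrable fun t : ℝ => f (b + t * I) / (b + t * I))
    (hdecay : ∀ ε : ℝ, 0 < ε → ∃ T₀ : ℝ, ∀ σ ∈ Icc a b, ∀ T : ℝ, T₀ ≤ |T| →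
      ‖f (σ + T * I) / (σ + T * I)‖ ≤ ε) :
    (∫ t : ℝ, f (b + t * I) / (b + t * I)) - ∫ t : ℝ, f (a + t * I) / (a + t * I) =
      2 * π * f 0 := by
  have hab : a ≤ b := (ha.trans hb).le
  -- Cauchy's integral formula on the rectangle with corners `a - iT`, `b + iT` (`T > 0`)
  have hrect : ∀ T : ℝ, 0 < T →
      (∫ x in a..b, f (x + (-T : ℝ) * I) / (x + (-T : ℝ) * I)) -
          (∫ x in a..b, f (x + T * I) / (x + T * I)) +
        I * (∫ y in (-T : ℝ)..T, f (b + y * I) / (b + y * I)) -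
        I * (∫ y in (-T : ℝ)..T, f (a + y * I) / (a + y * I)) = 2 * π * I * f 0 := by
    intro T hT
    have h := Literature.Analysis.Complex.integral_boundary_rect_div_sub_eq (f := f) 0
      (a := a) (b := b) (c := -T) (d := T) (by simpa using ha) (by simpa using hb)
      (by simpa using hT) (by simpa using hT) (hfd.mono fun z hz ↦ ⟨hz.1, mem_univ _⟩)
    simpa only [sub_zero] using h
  -- limits of the vertical pieces
  have hVa : Tendsto (fun T : ℝ => ∫ y in (-T : ℝ)..T, f (a + y * I) / (a + y * I)) atTop
      (𝓝 (∫ t : ℝ, f (a + t * I) / (a + t * I))) :=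
    intervalIntegral_tendsto_integral hFa tendsto_neg_atTop_atBot tendsto_id
  have hVb : Tendsto (fun T : ℝ => ∫ y in (-T : ℝ)..T, f (b + y * I) / (b + y * I)) atTop
      (𝓝 (∫ t : ℝ, f (b + t * I) / (b + t * I))) :=
    intervalIntegral_tendsto_integral hFb tendsto_neg_atTop_atBot tendsto_id
  -- limits of the horizontal pieces
  have hH : ∀ s : ℝ, s = 1 ∨ s = -1 →
      Tendsto (fun T : ℝ => ∫ x in a..b, f (x + (s * T : ℝ) * I) / (x + (s * T : ℝ) * I))
        atTop (𝓝 0) := by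
    intro s hs
    rw [NormedAddGroup.tendsto_nhds_zero]
    intro ε hε
    obtain ⟨T₀, hT₀⟩ := hdecay (ε / (2 * (|b - a| + 1))) (by positivity)
    filter_upwards [eventually_ge_atTop (max T₀ 0)] with T hT
    have hTabs : T₀ ≤ |s * T| := by
      rcases hs with rfl | rfl <;> simp [abs_of_nonneg (le_of_max_le_right hT)] <;>
        exact le_of_max_le_left hT
    have hbound : ∀ x ∈ uIoc a b, ‖f (x + (s * T : ℝ) * I) / (x + (s * T : ℝ) * I)‖ ≤
        ε / (2 * (|b - a| + 1)) := by
      intro x hx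
      rw [uIoc_of_le hab] at hx
      exact hT₀ x ⟨hx.1.le, hx.2⟩ _ hTabs
    refine (intervalIntegral.norm_integral_le_of_norm_le_const hbound).trans_lt ?_
    rw [div_mul_eq_mul_div, div_lt_iff₀ (by positivity)]
    nlinarith [abs_nonneg (b - a)]
  have hH1 := hH 1 (Or.inl rfl)
  have hH2 := hH (-1) (Or.inr rfl)
  simp only [one_mul] at hH1
  simp only [neg_mul, one_mul] at hH2
  -- combine
  have hlim : Tendsto (fun T : ℝ =>
      (∫ x in a..b, f (x + (-T : ℝ) * I) / (x + (-T : ℝ) * I)) -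
          (∫ x in a..b, f (x + T * I) / (x + T * I)) +
        I * (∫ y in (-T : ℝ)..T, f (b + y * I) / (b + y * I)) -
        I * (∫ y in (-T : ℝ)..T, f (a + y * I) / (a + y * I))) atTop
      (𝓝 (0 - 0 + I * (∫ t : ℝ, f (b + t * I) / (b + t * I)) -
        I * (∫ t : ℝ, f (a + t * I) / (a + t * I)))) :=
    ((hH2.sub hH1).add (hVb.const_mul I)).sub (hVa.const_mul I)
  have hconst : Tendsto (fun T : ℝ =>
      (∫ x in a..b, f (x + (-T : ℝ) * I) / (x + (-T : ℝ) * I)) -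
          (∫ x in a..b, f (x + T * I) / (x + T * I)) +
        I * (∫ y in (-T : ℝ)..T, f (b + y * I) / (b + y * I)) -
        I * (∫ y in (-T : ℝ)..T, f (a + y * I) / (a + y * I))) atTop
      (𝓝 (2 * π * I * f 0)) := by
    refine tendsto_const_nhds.congr' ?_
    filter_upwards [eventually_gt_atTop 0] with T hT
    exact (hrect T hT).symm
  have heq := tendsto_nhds_unique hlim hconst
  simp only [sub_zero, zero_add] at heq
  have : I * ((∫ t : ℝ, f (b + t * I) / (b + t * I)) - ∫ t : ℝ, f (a + t * I) / (a + t * I)) =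
      I * (2 * π * f 0) := by
    rw [mul_sub, heq]; ring
  exact mul_left_cancel₀ I_ne_zero this


/-! ### The smoothed Perron formula on `Re w = 2` for the shifted series `∑ μ(m) m^{-s} m^{-w}` -/

/-- **Smoothed Perron formula on `Re w = 2`, shifted series.** For `Φ` integrable on the line
`Re w = 2` whose inverse Mellin transform at abscissa `2` is `φ` on `(0, ∞)`, `x > 0` and
`Re s ≥ 0`: `∫ Φ(2+it) x^{2+it} ζ(s+2+it)^{-1} dt = 2π ∑' μ(m) m^{-s} φ(m/x)` (insert
`1/ζ(s+w) = ∑ μ(m) m^{-s} m^{-w}` and integrate termwise). [folklore] -/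
theorem integral_vertical_two_eq_tsum_shift (Φ : ℂ → ℂ) (φ : ℝ → ℂ)
    (hΦi : Integrable fun t : ℝ => Φ (2 + t * I))
    (hinv : ∀ y : ℝ, 0 < y → mellinInv 2 Φ y = φ y) {x : ℝ} (hx : 0 < x) {s : ℂ}
    (hs : 0 ≤ s.re) :
    ∫ t : ℝ, Φ (2 + t * I) * (x : ℂ) ^ (2 + t * I : ℂ) * (riemannZeta (s + (2 + t * I)))⁻¹ =
      2 * π * ∑' n : ℕ, (ArithmeticFunction.moebius n : ℂ) / (n : ℂ) ^ s * φ (n / x) := by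
  set μf : ℕ → ℂ := fun n => (ArithmeticFunction.moebius n : ℂ) with hμf
  set F : ℕ → ℝ → ℂ := fun n t =>
    ((x : ℂ) ^ (2 + t * I : ℂ) * LSeries.term μf (s + (2 + t * I)) n) * Φ (2 + t * I) with hF
  have hre : ∀ t : ℝ, (s + (2 + t * I : ℂ)).re = s.re + 2 := fun t => by simp
  have hre2 : ∀ t : ℝ, (2 + t * I : ℂ).re = 2 := fun t => by simp
  have hxs : ∀ t : ℝ, ‖(x : ℂ) ^ (2 + t * I : ℂ)‖ = x ^ (2 : ℝ) := fun t => by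
    rw [Complex.norm_cpow_eq_rpow_re_of_pos hx, hre2]
  have hμle : ∀ n : ℕ, ‖μf n‖ ≤ 1 := fun n => by
    rw [hμf]; simp only [Complex.norm_intCast]
    exact_mod_cast ArithmeticFunction.abs_moebius_le_one
  -- norm of the terms
  have hterm : ∀ (n : ℕ) (t : ℝ), ‖LSeries.term μf (s + (2 + t * I)) n‖ =
      if n = 0 then 0 else ‖μf n‖ / (n : ℝ) ^ (s.re + 2) := by
    intro n t
    rcases eq_or_ne n 0 with rfl | hn
    · simp
    · rw [LSeries.term_of_ne_zero hn, if_neg hn, norm_div,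
        Complex.norm_natCast_cpow_of_pos (Nat.pos_of_ne_zero hn), hre]
  have hterm_le : ∀ (n : ℕ) (t : ℝ), ‖LSeries.term μf (s + (2 + t * I)) n‖ ≤
      if n = 0 then 0 else 1 / (n : ℝ) ^ (2 : ℝ) := by
    intro n t
    rw [hterm]
    split_ifs with hn
    · exact le_rfl
    · have hn1 : (1 : ℝ) ≤ n := by exact_mod_cast Nat.pos_of_ne_zero hn
      have hn2 : (n : ℝ) ^ (2 : ℝ) ≤ (n : ℝ) ^ (s.re + 2) :=
        Real.rpow_le_rpow_of_exponent_le hn1 (by linarith)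
      exact div_le_div₀ zero_le_one (hμle n) (by positivity) hn2
  have hterm_le_one : ∀ (n : ℕ) (t : ℝ), ‖LSeries.term μf (s + (2 + t * I)) n‖ ≤ 1 := by
    intro n t
    refine (hterm_le n t).trans ?_
    split_ifs with hn
    · exact zero_le_one
    · have hn1 : (1 : ℝ) ≤ n := by exact_mod_cast Nat.pos_of_ne_zero hn
      rw [div_le_one (by positivity)]
      exact Real.one_le_rpow hn1 (by norm_num)
  -- continuity in `t` of the pieces
  have hline : Continuous fun t : ℝ => (2 + t * I : ℂ) := by fun_prop
  have hline' : Continuous fun t : ℝ => (s + (2 + t * I) : ℂ) := by fun_prop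
  have hxc : Continuous fun t : ℝ => (x : ℂ) ^ (2 + t * I : ℂ) :=
    hline.const_cpow (Or.inl (by exact_mod_cast hx.ne'))
  have htc : ∀ n : ℕ, Continuous fun t : ℝ => LSeries.term μf (s + (2 + t * I)) n := by
    intro n
    rcases eq_or_ne n 0 with rfl | hn
    · simp only [LSeries.term_zero]; exact continuous_const
    · simp only [LSeries.term_of_ne_zero hn]
      refine continuous_const.div (hline'.const_cpow (Or.inl (by exact_mod_cast hn))) fun t => ?_
      exact (cpow_ne_zero_iff_of_exponent_ne_zero (by
        intro h0; have := congrArg Complex.re h0; simp at this; linarith)).mpr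
          (by exact_mod_cast hn)
  -- integrability of each `F n`
  have hFi : ∀ n : ℕ, Integrable (F n) := by
    intro n
    refine hΦi.bdd_mul (c := x ^ (2 : ℝ) * 1) (hxc.mul (htc n)).aestronglyMeasurable
      (Eventually.of_forall fun t => ?_)
    rw [norm_mul, hxs]
    gcongr
    exact hterm_le_one n t
  -- the norms are bounded by `x² n^{-2} ∫ ‖Φ‖`
  have hFnorm : ∀ n : ℕ, ∫ t : ℝ, ‖F n t‖ ≤
      (x ^ (2 : ℝ) * (if n = 0 then 0 else 1 / (n : ℝ) ^ (2 : ℝ))) *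
        ∫ t : ℝ, ‖Φ (2 + t * I)‖ := by
    intro n
    rw [← integral_const_mul]
    refine integral_mono_of_nonneg (Eventually.of_forall fun t => norm_nonneg _)
      (hΦi.norm.const_mul _) (Eventually.of_forall fun t => ?_)
    simp only [hF, norm_mul, hxs]
    gcongr
    exact hterm_le n t
  have hsum : Summable fun n : ℕ => ∫ t : ℝ, ‖F n t‖ := by
    refine Summable.of_nonneg_of_le (fun n => integral_nonneg fun t => norm_nonneg _) hFnorm ?_
    refine (Summable.mul_right _ (Summable.mul_left _ ?_))
    refine Summable.of_nonneg_of_le (f := fun n : ℕ => 1 / (n : ℝ) ^ (2 : ℝ)) (fun n => ?_)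
      (fun n => ?_) (Real.summable_one_div_nat_rpow.mpr (by norm_num))
    · split_ifs <;> positivity
    · split_ifs with hn
      · positivity
      · exact le_rfl
  -- rewrite the integrand as `∑' F n t`
  have hexpand : ∀ t : ℝ,
      Φ (2 + t * I) * (x : ℂ) ^ (2 + t * I : ℂ) * (riemannZeta (s + (2 + t * I)))⁻¹ =
        ∑' n : ℕ, F n t := by
    intro t
    rw [inv_riemannZeta_eq_LSeries (by rw [hre]; linarith), LSeries, ← tsum_mul_left]
    refine tsum_congr fun n => ?_
    simp only [hF]; ring
  simp_rw [hexpand]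
  rw [← integral_tsum_of_summable_integral_norm hFi hsum]
  -- evaluate `∫ F n`
  have hFint : ∀ n : ℕ, ∫ t : ℝ, F n t = 2 * π * (μf n / (n : ℂ) ^ s * φ (n / x)) := by
    intro n
    rcases eq_or_ne n 0 with rfl | hn
    · simp [hF, hμf]
    · have hn0 : (0 : ℝ) < n := by exact_mod_cast Nat.pos_of_ne_zero hn
      have hnC : (n : ℂ) ≠ 0 := by exact_mod_cast hn
      have hnx : (0 : ℝ) < n / x := div_pos hn0 hx
      have hFn : ∀ t : ℝ, F n t =
          μf n / (n : ℂ) ^ s * ((((n / x : ℝ) : ℂ)) ^ (-(2 + t * I : ℂ)) • Φ (2 + t * I)) := by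
        intro t
        simp only [hF, LSeries.term_of_ne_zero hn, smul_eq_mul]
        rw [← cpow_div_cpow_eq hn0 hx, cpow_add _ _ hnC]
        push_cast
        field_simp
      simp_rw [hFn]
      rw [integral_const_mul, ← hinv _ hnx, mellinInv]
      rw [Complex.real_smul]
      push_cast
      field_simp
      simp only [mul_comm I]
  simp_rw [hFint]
  rw [tsum_mul_left]


/-! ### The kernel `Ψ_h(w) = w Φ_h(w)` and the integrand `f(w) = Ψ_h(w) x^w ζinv(s+w)`

`Ψ_h(w) = ((1+h)^{w+1} − 1)/(h (w+1))` is the pole-free part of the Mellin transform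
`Φ_h(w) = Ψ_h(w)/w` of the cutoff `φ_h` (`MertensBoundRH.Phi`), with `Ψ_h(0) = 1`; the smoothed
Perron integrand is `Φ_h(w) x^w ζinv(s+w) = f(w)/w` with `f(w) = Ψ_h(w) x^w ζinv(s+w)` holomorphic
near `w = 0` and `f(0) = ζinv(s)`. Both `Ψ_h` and `f` are written out (the lemmas on `f` take the
defining identity `hf` as a hypothesis), so that this file declares no definitions. -/

variable {h x : ℝ}

/-- `Φ_h(w) = Ψ_h(w)/w`. [folklore] -/
lemma Phi_eq_Psi_div (h : ℝ) (w : ℂ) :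
    Phi h w = ((((1 + h : ℝ)) : ℂ) ^ (w + 1) - 1) / (h * (w + 1)) / w := by
  unfold Phi
  rw [div_div, mul_right_comm]

/-- `‖Ψ_h(w)‖ ≤ 8` for `0 < h ≤ 1`, `Re w ≤ 2`, `w ≠ -1` (mean-value bound
`‖(1+h)^{w+1} − 1‖ ≤ 8‖w+1‖h`). [folklore] -/
lemma norm_Psi_le_eight (hh : 0 < h) (hh1 : h ≤ 1) {w : ℂ} (hw2 : w.re ≤ 2) (hw1 : w + 1 ≠ 0) :
    ‖((((1 + h : ℝ)) : ℂ) ^ (w + 1) - 1) / (h * (w + 1))‖ ≤ 8 := by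
  have hn : 0 < ‖w + 1‖ := norm_pos_iff.mpr hw1
  rw [norm_div, norm_mul, Complex.norm_real, Real.norm_eq_abs, abs_of_pos hh,
    div_le_iff₀ (by positivity)]
  calc ‖(((1 + h : ℝ)) : ℂ) ^ (w + 1) - 1‖ ≤ 8 * ‖w + 1‖ * h := norm_cpow_sub_one_le_mul hh hh1 hw2
    _ = 8 * (h * ‖w + 1‖) := by ring

/-- `‖Ψ_h(w)‖ ≤ 9/(h‖w+1‖)` for `0 < h ≤ 1`, `-1 ≤ Re w ≤ 2`, `w ≠ -1`. [folklore] -/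
lemma norm_Psi_le_div (hh : 0 < h) (hh1 : h ≤ 1) {w : ℂ} (hw0 : -1 ≤ w.re) (hw2 : w.re ≤ 2)
    (hw1 : w + 1 ≠ 0) :
    ‖((((1 + h : ℝ)) : ℂ) ^ (w + 1) - 1) / (h * (w + 1))‖ ≤ 9 / (h * ‖w + 1‖) := by
  have hn : 0 < ‖w + 1‖ := norm_pos_iff.mpr hw1
  rw [norm_div, norm_mul, Complex.norm_real, Real.norm_eq_abs, abs_of_pos hh]
  gcongr
  exact norm_cpow_sub_one_le_nine hh hh1 hw0 hw2

/-- Interpolated bound `‖Ψ_h(w)‖ ≤ 9 h^{-η} ‖w+1‖^{-η}` (`0 ≤ η ≤ 1`). [folklore] -/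
lemma norm_Psi_le_rpow (hh : 0 < h) (hh1 : h ≤ 1) {w : ℂ} (hw0 : -1 ≤ w.re) (hw2 : w.re ≤ 2)
    (hw1 : w + 1 ≠ 0) {η : ℝ} (hη : 0 ≤ η) (hη1 : η ≤ 1) :
    ‖((((1 + h : ℝ)) : ℂ) ^ (w + 1) - 1) / (h * (w + 1))‖ ≤ 9 * h ^ (-η) * ‖w + 1‖ ^ (-η) := by
  set P : ℝ := ‖((((1 + h : ℝ)) : ℂ) ^ (w + 1) - 1) / (h * (w + 1))‖ with hP
  have hn : 0 < ‖w + 1‖ := norm_pos_iff.mpr hw1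
  have hA : P ≤ 9 := (norm_Psi_le_eight hh hh1 hw2 hw1).trans (by norm_num)
  have hB : P ≤ 9 / (h * ‖w + 1‖) := norm_Psi_le_div hh hh1 hw0 hw2 hw1
  have h0 : 0 ≤ P := norm_nonneg _
  have hsplit : P = P ^ (1 - η) * P ^ η := by
    rw [← Real.rpow_add' h0 (by ring_nf; norm_num)]; ring_nf; simp
  rw [hsplit]
  calc P ^ (1 - η) * P ^ η
      ≤ (9 : ℝ) ^ (1 - η) * (9 / (h * ‖w + 1‖)) ^ η := by gcongr
    _ = ((9 : ℝ) ^ (1 - η) * 9 ^ η) * (h ^ η * ‖w + 1‖ ^ η)⁻¹ := by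
        rw [Real.div_rpow (by norm_num) (by positivity), Real.mul_rpow hh.le hn.le]
        ring
    _ = 9 * h ^ (-η) * ‖w + 1‖ ^ (-η) := by
        have e3 : (9 : ℝ) ^ (1 - η) * 9 ^ η = 9 := by
          rw [← Real.rpow_add (by norm_num)]; norm_num
        rw [e3, Real.rpow_neg hh.le, Real.rpow_neg hn.le, mul_inv]
        ring

/-- `Ψ_h` is holomorphic away from `w = -1` (`h > 0`). [folklore] -/
lemma differentiableAt_Psi (hh : 0 < h) {w : ℂ} (hw1 : w + 1 ≠ 0) :
    DifferentiableAt ℂ (fun w : ℂ => ((((1 + h : ℝ)) : ℂ) ^ (w + 1) - 1) / (h * (w + 1))) w := by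
  have hb : (((1 + h : ℝ)) : ℂ) ≠ 0 := by
    have : (1 + h : ℝ) ≠ 0 := by linarith
    exact_mod_cast this
  have hh' : (h : ℂ) ≠ 0 := by exact_mod_cast hh.ne'
  refine DifferentiableAt.div ?_ (by fun_prop) (mul_ne_zero hh' hw1)
  exact ((differentiableAt_id.add_const 1).const_cpow (Or.inl hb)).sub_const 1

variable {s : ℂ} {f : ℂ → ℂ}

/-- `Φ_h(w) x^w ζinv(s+w) = f(w)/w` for the pole-free integrand
`f(w) = Ψ_h(w) x^w ζinv(s+w)`. [folklore] -/
lemma Phi_mul_eq_fInt_div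
    (hf : ∀ w, f w = ((((1 + h : ℝ)) : ℂ) ^ (w + 1) - 1) / (h * (w + 1)) * (x : ℂ) ^ w *
      zetaInv (s + w)) (w : ℂ) :
    Phi h w * (x : ℂ) ^ w * zetaInv (s + w) = f w / w := by
  rw [hf, Phi_eq_Psi_div]
  ring

/-- `f(0) = ζinv(s)` (`Ψ_h(0) = 1`, i.e. the residue of `Φ_h` at `w = 0` is `φ_h(1) = 1`).
[folklore] -/
lemma fInt_zero (hh : h ≠ 0)
    (hf : ∀ w, f w = ((((1 + h : ℝ)) : ℂ) ^ (w + 1) - 1) / (h * (w + 1)) * (x : ℂ) ^ w *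
      zetaInv (s + w)) : f 0 = zetaInv s := by
  have : (h : ℂ) ≠ 0 := by exact_mod_cast hh
  rw [hf, zero_add, cpow_one, cpow_zero, add_zero, mul_one, mul_one]
  push_cast
  rw [add_sub_cancel_left, div_self this, one_mul]

variable {θ : ℝ}

/-- Under quasi-RH(`θ`), `f` is holomorphic on `Re w > θ − Re s`, `Re w > -1` (`h, x > 0`).
[folklore] -/
lemma differentiableOn_fInt (hQ : QuasiRiemannHypothesis θ) (hh : 0 < h) (hx : 0 < x)
    (hf : ∀ w, f w = ((((1 + h : ℝ)) : ℂ) ^ (w + 1) - 1) / (h * (w + 1)) * (x : ℂ) ^ w *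
      zetaInv (s + w)) :
    DifferentiableOn ℂ f {w : ℂ | θ - s.re < w.re ∧ -1 < w.re} := by
  rw [show f = fun w => ((((1 + h : ℝ)) : ℂ) ^ (w + 1) - 1) / (h * (w + 1)) * (x : ℂ) ^ w *
      zetaInv (s + w) from funext hf]
  intro w hw
  have hw1 : w + 1 ≠ 0 := fun h0 => by
    have := congrArg re h0; simp at this; linarith [hw.2]
  refine DifferentiableAt.differentiableWithinAt ?_
  refine DifferentiableAt.mul (DifferentiableAt.mul (differentiableAt_Psi hh hw1) ?_) ?_
  · exact differentiableAt_id.const_cpow (Or.inl (by exact_mod_cast hx.ne'))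
  · have hsw : θ < (s + w).re := by simp; linarith [hw.1]
    have hopen : IsOpen {u : ℂ | θ < u.re} := isOpen_lt continuous_const continuous_re
    exact ((MertensBoundQuasiRH.differentiableOn_zetaInv hQ).differentiableAt
      (hopen.mem_nhds hsw)).comp w (differentiableAt_id.const_add s)

/-- Continuity of `t ↦ f(u+it)/(u+it)` on a vertical line `Re w = u ≠ 0` inside the region of
holomorphy. [folklore] -/
lemma continuous_fInt_div_vertical (hQ : QuasiRiemannHypothesis θ) (hh : 0 < h) (hx : 0 < x)
    (hf : ∀ w, f w = ((((1 + h : ℝ)) : ℂ) ^ (w + 1) - 1) / (h * (w + 1)) * (x : ℂ) ^ w *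
      zetaInv (s + w)) {u : ℝ} (hu0 : u ≠ 0) (hu1 : θ - s.re < u) (hu2 : -1 < u) :
    Continuous fun t : ℝ => f (u + t * I) / (u + t * I) := by
  have hline : Continuous fun t : ℝ => ((u : ℂ) + t * I) := by fun_prop
  refine Continuous.div ?_ hline fun t h0 => hu0 (by simpa using congrArg re h0)
  exact (differentiableOn_fInt hQ hh hx hf).continuousOn.comp_continuous hline
    fun t => ⟨by simpa using hu1, by simpa using hu2⟩

/-! ### Bounds for the integrand from a bound `‖ζinv(σ'+it')‖ ≤ K(1+|t'|)^ε₁` on `σ' ≥ σ₁` -/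

/-- Transport of the `ζinv` bound to the shifted argument `s + w`, `w = u + iv`, `Re s + u ≥ σ₁`:
`‖ζinv(s+w)‖ ≤ K (1+|Im s|)^{ε₁} (1+|v|)^{ε₁}`. [folklore] -/
lemma norm_zetaInv_shift_le {K ε₁ σ₁ : ℝ} (hK0 : 0 ≤ K) (hε₁ : 0 ≤ ε₁)
    (hK : ∀ σ' t' : ℝ, σ₁ ≤ σ' → ‖zetaInv (σ' + t' * I)‖ ≤ K * (1 + |t'|) ^ ε₁)
    (s : ℂ) {u : ℝ} (hu : σ₁ ≤ s.re + u) (v : ℝ) :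
    ‖zetaInv (s + (u + v * I))‖ ≤ K * (1 + |s.im|) ^ ε₁ * (1 + |v|) ^ ε₁ := by
  have e2 : s + ((u : ℂ) + v * I) = ((s.re + u : ℝ) : ℂ) + ((s.im + v : ℝ) : ℂ) * I := by
    apply Complex.ext <;> simp
  rw [e2]
  refine (hK _ _ hu).trans ?_
  have hsplit : (1 + |s.im + v|) ^ ε₁ ≤ (1 + |s.im|) ^ ε₁ * (1 + |v|) ^ ε₁ := by
    rw [← Real.mul_rpow (by positivity) (by positivity)]
    refine Real.rpow_le_rpow (by positivity) ?_ hε₁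
    have := abs_add_le s.im v
    nlinarith [abs_nonneg s.im, abs_nonneg v]
  calc K * (1 + |s.im + v|) ^ ε₁ ≤ K * ((1 + |s.im|) ^ ε₁ * (1 + |v|) ^ ε₁) := by gcongr
    _ = K * (1 + |s.im|) ^ ε₁ * (1 + |v|) ^ ε₁ := by ring

/-- `‖x^w‖ ≤ x²` on `Re w ≤ 2` for `x ≥ 1`. [folklore] -/
lemma norm_cpow_le_sq (hx : 1 ≤ x) {w : ℂ} (hw : w.re ≤ 2) : ‖(x : ℂ) ^ w‖ ≤ x ^ 2 := by
  rw [Complex.norm_cpow_eq_rpow_re_of_pos (by linarith)]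
  calc x ^ w.re ≤ x ^ (2 : ℝ) := Real.rpow_le_rpow_of_exponent_le hx hw
    _ = x ^ 2 := by norm_num

/-- **Horizontal decay.** On `Re w = u ∈ [-1/2, 2]` with `Re s + u ≥ σ₁`, `|T| ≥ 1`, `x ≥ 1`:
`‖f(u+iT)/(u+iT)‖ ≤ 18 x² K (1+|Im s|)^{ε₁} / (h|T|)` (`ε₁ ≤ 1`). [folklore] -/
lemma norm_fInt_div_horizontal_le (hh : 0 < h) (hh1 : h ≤ 1) (hx : 1 ≤ x) {K ε₁ σ₁ : ℝ}
    (hK0 : 0 ≤ K) (hε₁ : 0 ≤ ε₁) (hε₁1 : ε₁ ≤ 1)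
    (hK : ∀ σ' t' : ℝ, σ₁ ≤ σ' → ‖zetaInv (σ' + t' * I)‖ ≤ K * (1 + |t'|) ^ ε₁)
    (hf : ∀ w, f w = ((((1 + h : ℝ)) : ℂ) ^ (w + 1) - 1) / (h * (w + 1)) * (x : ℂ) ^ w *
      zetaInv (s + w)) {u : ℝ} (hsu : σ₁ ≤ s.re + u) (hu0 : -1 / 2 ≤ u) (hu2 : u ≤ 2) {T : ℝ}
    (hT : 1 ≤ |T|) :
    ‖f (u + T * I) / (u + T * I)‖ ≤ 18 * x ^ 2 * K * (1 + |s.im|) ^ ε₁ / (h * |T|) := by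
  set w : ℂ := (u : ℂ) + T * I with hw
  have hwre : w.re = u := by simp [hw]
  have hTpos : 0 < |T| := by linarith
  have hwn : |T| ≤ ‖w‖ := by simpa [hw] using abs_im_le_norm w
  have hw1n : |T| ≤ ‖w + 1‖ := by simpa [hw] using abs_im_le_norm (w + 1)
  have hw1 : w + 1 ≠ 0 := norm_pos_iff.mp (by linarith)
  have hΨ := norm_Psi_le_div hh hh1 (w := w) (by rw [hwre]; linarith) (by rw [hwre]; exact hu2) hw1
  have hxw := norm_cpow_le_sq hx (w := w) (by rw [hwre]; exact hu2)
  have hζ := norm_zetaInv_shift_le hK0 hε₁ hK s (u := u) hsu T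
  have hpow : (1 + |T|) ^ ε₁ ≤ 2 * |T| := by
    calc (1 + |T|) ^ ε₁ ≤ (1 + |T|) ^ (1 : ℝ) :=
          Real.rpow_le_rpow_of_exponent_le (by linarith) hε₁1
      _ = 1 + |T| := Real.rpow_one _
      _ ≤ 2 * |T| := by linarith
  rw [norm_div, hf, norm_mul, norm_mul, div_le_iff₀ (by linarith : (0 : ℝ) < ‖w‖)]
  have hA : 0 ≤ x ^ 2 := by positivity
  have hB : 0 ≤ K * (1 + |s.im|) ^ ε₁ := by positivity
  calc ‖((((1 + h : ℝ)) : ℂ) ^ (w + 1) - 1) / (h * (w + 1))‖ * ‖(x : ℂ) ^ w‖ *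
        ‖zetaInv (s + (u + T * I))‖
      ≤ (9 / (h * ‖w + 1‖)) * x ^ 2 * (K * (1 + |s.im|) ^ ε₁ * (1 + |T|) ^ ε₁) := by
        gcongr
    _ ≤ (9 / (h * |T|)) * x ^ 2 * (K * (1 + |s.im|) ^ ε₁ * (2 * |T|)) := by gcongr
    _ = 18 * x ^ 2 * K * (1 + |s.im|) ^ ε₁ / (h * |T|) * |T| := by
        field_simp
        ring
    _ ≤ 18 * x ^ 2 * K * (1 + |s.im|) ^ ε₁ / (h * |T|) * ‖w‖ := by gcongr

/-- **Pointwise bound on the right line `Re w = 2`:**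
`‖f(2+it)/(2+it)‖ ≤ 18 x² K (1+|Im s|)^{ε₁} h⁻¹ (1+|t|)^{-(2-ε₁)}` (`Re s + 2 ≥ σ₁`). [folklore] -/
lemma norm_fInt_div_two_le (hh : 0 < h) (hh1 : h ≤ 1) (hx : 1 ≤ x) {K ε₁ σ₁ : ℝ}
    (hK0 : 0 ≤ K) (hε₁ : 0 ≤ ε₁)
    (hK : ∀ σ' t' : ℝ, σ₁ ≤ σ' → ‖zetaInv (σ' + t' * I)‖ ≤ K * (1 + |t'|) ^ ε₁)
    (hf : ∀ w, f w = ((((1 + h : ℝ)) : ℂ) ^ (w + 1) - 1) / (h * (w + 1)) * (x : ℂ) ^ w *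
      zetaInv (s + w)) (hs : σ₁ ≤ s.re + 2) (t : ℝ) :
    ‖f ((2 : ℝ) + t * I) / ((2 : ℝ) + t * I)‖ ≤
      (18 * x ^ 2 * K * (1 + |s.im|) ^ ε₁ / h) * (1 + ‖t‖) ^ (-(2 - ε₁)) := by
  rw [← Phi_mul_eq_fInt_div hf, norm_mul, norm_mul]
  have hΦ := norm_Phi_vertical_le hh hh1 (σ := 2) two_pos le_rfl t
  rw [show min ((2 : ℝ) ^ 2) 1 = 1 by norm_num, mul_one] at hΦ
  have hxw := norm_cpow_le_sq hx (w := ((2 : ℝ) : ℂ) + t * I) (by simp)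
  have hζ := norm_zetaInv_shift_le hK0 hε₁ hK s (u := 2) hs t
  have hu : 0 < 1 + |t| := by positivity
  have h2' : (1 + t ^ 2)⁻¹ ≤ 2 * (1 + |t|) ^ (-(2 : ℝ)) := by
    rw [Real.rpow_neg hu.le, show ((1 + |t|) ^ (2 : ℝ) : ℝ) = (1 + |t|) ^ 2 by norm_num,
      ← div_eq_mul_inv, le_div_iff₀ (by positivity)]
    have : (1 + |t|) ^ 2 ≤ 2 * (1 + t ^ 2) := by
      have := sq_abs t; nlinarith [abs_nonneg t, sq_nonneg (|t| - 1)]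
    calc (1 + t ^ 2)⁻¹ * (1 + |t|) ^ 2 ≤ (1 + t ^ 2)⁻¹ * (2 * (1 + t ^ 2)) := by gcongr
      _ = 2 := by field_simp
  have hA : 0 ≤ x ^ 2 := by positivity
  calc ‖Phi h (((2 : ℝ) : ℂ) + t * I)‖ * ‖(x : ℂ) ^ (((2 : ℝ) : ℂ) + t * I)‖ *
        ‖zetaInv (s + (((2 : ℝ) : ℂ) + t * I))‖
      ≤ (9 / h * (1 + t ^ 2)⁻¹) * x ^ 2 * (K * (1 + |s.im|) ^ ε₁ * (1 + |t|) ^ ε₁) := by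
        gcongr
    _ ≤ (9 / h * (2 * (1 + |t|) ^ (-(2 : ℝ)))) * x ^ 2 *
          (K * (1 + |s.im|) ^ ε₁ * (1 + |t|) ^ ε₁) := by gcongr
    _ = (18 * x ^ 2 * K * (1 + |s.im|) ^ ε₁ / h) * ((1 + |t|) ^ (-(2 : ℝ)) * (1 + |t|) ^ ε₁) := by
        field_simp
        ring
    _ = (18 * x ^ 2 * K * (1 + |s.im|) ^ ε₁ / h) * (1 + ‖t‖) ^ (-(2 - ε₁)) := by
        rw [← Real.rpow_add hu, Real.norm_eq_abs]; congr 1; ring_nf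

/-- **Pointwise bound on a left line `Re w = -η'`** (`0 < η' ≤ 1/2`, `Re s - η' ≥ σ₁`,
`0 ≤ ε₁ ≤ 1/4`): `‖f(-η'+it)/(-η'+it)‖ ≤ (36K/η') h^{-2ε₁} x^{-η'} (1+|Im s|)^{ε₁} (1+|t|)^{-(1+ε₁)}`.
[folklore] -/
lemma norm_fInt_div_left_le (hh : 0 < h) (hh1 : h ≤ 1) (hx : 0 < x) {K ε₁ σ₁ : ℝ}
    (hK0 : 0 ≤ K) (hε₁ : 0 ≤ ε₁) (hε₁1 : ε₁ ≤ 1 / 4)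
    (hK : ∀ σ' t' : ℝ, σ₁ ≤ σ' → ‖zetaInv (σ' + t' * I)‖ ≤ K * (1 + |t'|) ^ ε₁)
    (hf : ∀ w, f w = ((((1 + h : ℝ)) : ℂ) ^ (w + 1) - 1) / (h * (w + 1)) * (x : ℂ) ^ w *
      zetaInv (s + w)) {η' : ℝ} (hη'0 : 0 < η') (hη'1 : η' ≤ 1 / 2) (hs : σ₁ ≤ s.re + -η')
    (t : ℝ) :
    ‖f ((-η' : ℝ) + t * I) / ((-η' : ℝ) + t * I)‖ ≤
      (36 * K / η' * h ^ (-(2 * ε₁)) * x ^ (-η') * (1 + |s.im|) ^ ε₁) *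
        (1 + ‖t‖) ^ (-(1 + ε₁)) := by
  set w : ℂ := ((-η' : ℝ) : ℂ) + t * I with hw
  have hwre : w.re = -η' := by simp [hw]
  have hu : 0 < 1 + |t| := by positivity
  -- lower bounds for `‖w‖` and `‖w + 1‖`
  have hwn1 : |t| ≤ ‖w‖ := by simpa [hw] using abs_im_le_norm w
  have hwn2 : η' ≤ ‖w‖ := by
    have := abs_re_le_norm w
    rw [hwre, abs_of_neg (by linarith), neg_neg] at this
    exact this
  have hwn : η' / 2 * (1 + |t|) ≤ ‖w‖ := by
    rcases le_or_gt |t| 1 with ht | ht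
    · nlinarith
    · nlinarith
  have hw1n1 : |t| ≤ ‖w + 1‖ := by simpa [hw] using abs_im_le_norm (w + 1)
  have hw1n2 : 1 / 2 ≤ ‖w + 1‖ := by
    have := abs_re_le_norm (w + 1)
    rw [add_re, one_re, hwre, abs_of_pos (by linarith)] at this
    linarith
  have hw1n : (1 + |t|) / 4 ≤ ‖w + 1‖ := by
    rcases le_or_gt |t| 1 with ht | ht
    · linarith
    · linarith
  have hwpos : 0 < ‖w‖ := by linarith
  have hw1 : w + 1 ≠ 0 := norm_pos_iff.mp (by linarith)
  -- the three factors
  have hΨ := norm_Psi_le_rpow hh hh1 (w := w) (by rw [hwre]; linarith) (by rw [hwre]; linarith)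
    hw1 (η := 2 * ε₁) (by linarith) (by linarith)
  have hxw : ‖(x : ℂ) ^ w‖ = x ^ (-η') := by
    rw [Complex.norm_cpow_eq_rpow_re_of_pos hx, hwre]
  have hζ := norm_zetaInv_shift_le hK0 hε₁ hK s (u := -η') hs t
  -- `‖w+1‖^{-2ε₁} ≤ 2 (1+|t|)^{-2ε₁}` and `1/‖w‖ ≤ (2/η') (1+|t|)^{-1}`
  have hw1pow : ‖w + 1‖ ^ (-(2 * ε₁)) ≤ 2 * (1 + |t|) ^ (-(2 * ε₁)) := by
    calc ‖w + 1‖ ^ (-(2 * ε₁)) ≤ ((1 + |t|) / 4) ^ (-(2 * ε₁)) :=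
          Real.rpow_le_rpow_of_nonpos (by positivity) hw1n (by linarith)
      _ = (4 : ℝ) ^ (2 * ε₁) * (1 + |t|) ^ (-(2 * ε₁)) := by
          rw [Real.div_rpow hu.le (by norm_num : (0 : ℝ) ≤ 4),
            Real.rpow_neg (by norm_num : (0 : ℝ) ≤ 4), div_inv_eq_mul, mul_comm]
      _ ≤ 2 * (1 + |t|) ^ (-(2 * ε₁)) := by
          gcongr
          calc (4 : ℝ) ^ (2 * ε₁) ≤ (4 : ℝ) ^ (1 / 2 : ℝ) :=
                Real.rpow_le_rpow_of_exponent_le (by norm_num) (by linarith)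
            _ = 2 := by
                rw [show (4 : ℝ) = 2 ^ (2 : ℝ) by norm_num, ← Real.rpow_mul (by norm_num)]
                norm_num
  have hwinv : ‖w‖⁻¹ ≤ 2 / η' * (1 + |t|) ^ (-(1 : ℝ)) := by
    rw [Real.rpow_neg hu.le, Real.rpow_one, ← div_eq_mul_inv, div_div,
      inv_eq_one_div, div_le_div_iff₀ hwpos (by positivity)]
    nlinarith
  -- assemble
  rw [norm_div, div_eq_mul_inv, hf, norm_mul, norm_mul, hxw]
  have hP : 0 ≤ x ^ (-η') := Real.rpow_nonneg hx.le _
  calc ‖((((1 + h : ℝ)) : ℂ) ^ (w + 1) - 1) / (h * (w + 1))‖ * x ^ (-η') *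
        ‖zetaInv (s + ((-η' : ℝ) + t * I))‖ * ‖w‖⁻¹
      ≤ (9 * h ^ (-(2 * ε₁)) * ‖w + 1‖ ^ (-(2 * ε₁))) * x ^ (-η') *
          (K * (1 + |s.im|) ^ ε₁ * (1 + |t|) ^ ε₁) * (2 / η' * (1 + |t|) ^ (-(1 : ℝ))) := by
        gcongr
    _ ≤ (9 * h ^ (-(2 * ε₁)) * (2 * (1 + |t|) ^ (-(2 * ε₁)))) * x ^ (-η') *
          (K * (1 + |s.im|) ^ ε₁ * (1 + |t|) ^ ε₁) * (2 / η' * (1 + |t|) ^ (-(1 : ℝ))) := by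
        gcongr
    _ = (36 * K / η' * h ^ (-(2 * ε₁)) * x ^ (-η') * (1 + |s.im|) ^ ε₁) *
          ((1 + |t|) ^ (-(2 * ε₁)) * (1 + |t|) ^ ε₁ * (1 + |t|) ^ (-(1 : ℝ))) := by ring
    _ = (36 * K / η' * h ^ (-(2 * ε₁)) * x ^ (-η') * (1 + |s.im|) ^ ε₁) *
          (1 + ‖t‖) ^ (-(1 + ε₁)) := by
        rw [← Real.rpow_add hu, ← Real.rpow_add hu, Real.norm_eq_abs]; congr 1; ring_nf

/-! ### De-smoothing: the smoothed sum versus the sharp partial sum -/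

/-- The smoothed shifted sum is a finite sum (`φ_h(m/n) = 0` for `m > n(1+h)`). [folklore] -/
lemma tsum_phi_eq_sum (hh : 0 < h) {n : ℕ} (hn : 0 < n) (s : ℂ) :
    ∑' m : ℕ, (ArithmeticFunction.moebius m : ℂ) / (m : ℂ) ^ s * (phi h (m / n) : ℂ) =
      ∑ m ∈ Finset.range (⌊(n : ℝ) * (1 + h)⌋₊ + 1),
        (ArithmeticFunction.moebius m : ℂ) / (m : ℂ) ^ s * (phi h (m / n) : ℂ) := by
  have hn' : (0 : ℝ) < n := by exact_mod_cast hn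
  refine tsum_eq_sum fun m hm => ?_
  simp only [Finset.mem_range, not_lt] at hm
  have h1 : (n : ℝ) * (1 + h) < m := (Nat.floor_lt (by positivity)).mp hm
  have h2 : 1 + h ≤ (m : ℝ) / n := by rw [le_div_iff₀ hn']; linarith
  simp [phi_of_ge hh h2]

/-- The sharp partial sum as a smoothed sum over `m ≤ n` (`φ_h(m/n) = 1` there, `μ(0) = 0`).
[folklore] -/
lemma sum_Icc_eq_sum_range_phi (hh : 0 < h) {n : ℕ} (hn : 0 < n) (s : ℂ) :
    ∑ m ∈ Finset.Icc 1 n, (ArithmeticFunction.moebius m : ℂ) / (m : ℂ) ^ s =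
      ∑ m ∈ Finset.range (n + 1),
        (ArithmeticFunction.moebius m : ℂ) / (m : ℂ) ^ s * (phi h (m / n) : ℂ) := by
  have hn' : (0 : ℝ) < n := by exact_mod_cast hn
  have hI : Finset.range (n + 1) = insert 0 (Finset.Icc 1 n) := by
    ext m; simp only [Finset.mem_range, Finset.mem_insert, Finset.mem_Icc]; omega
  rw [hI, Finset.sum_insert (by simp)]
  simp only [ArithmeticFunction.map_zero, Int.cast_zero, zero_div, zero_mul, zero_add]
  refine Finset.sum_congr rfl fun m hm => ?_
  rw [Finset.mem_Icc] at hm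
  have : (m : ℝ) / n ≤ 1 := by
    rw [div_le_one hn']; exact_mod_cast hm.2
  rw [phi_of_le_one hh this]
  simp

/-- **De-smoothing error:** for `0 < h`, `n ≥ 1`, `Re s ≥ 0`,
`‖∑' μ(m) m^{-s} φ_h(m/n) − ∑_{m ≤ n} μ(m) m^{-s}‖ ≤ n h · n^{-Re s}` (the two sums differ only in
the `≤ nh` terms `n < m ≤ n(1+h)`, each of modulus `≤ m^{-Re s} ≤ n^{-Re s}`). [folklore] -/
lemma norm_tsum_phi_sub_sum_le (hh : 0 < h) {n : ℕ} (hn : 0 < n) {s : ℂ} (hs : 0 ≤ s.re) :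
    ‖(∑' m : ℕ, (ArithmeticFunction.moebius m : ℂ) / (m : ℂ) ^ s * (phi h (m / n) : ℂ)) -
        ∑ m ∈ Finset.Icc 1 n, (ArithmeticFunction.moebius m : ℂ) / (m : ℂ) ^ s‖ ≤
      (n : ℝ) * h * (n : ℝ) ^ (-s.re) := by
  have hn' : (0 : ℝ) < n := by exact_mod_cast hn
  set N : ℕ := ⌊(n : ℝ) * (1 + h)⌋₊ with hN
  have hnN : n ≤ N := by
    rw [hN]
    refine Nat.le_floor ?_
    have : (n : ℝ) ≤ (n : ℝ) * (1 + h) := by nlinarith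
    exact_mod_cast this
  have hNle : (N : ℝ) ≤ (n : ℝ) * (1 + h) := Nat.floor_le (by positivity)
  set g : ℕ → ℂ := fun m =>
    (ArithmeticFunction.moebius m : ℂ) / (m : ℂ) ^ s * (phi h (m / n) : ℂ) with hg
  rw [tsum_phi_eq_sum hh hn s, sum_Icc_eq_sum_range_phi hh hn s,
    ← Finset.sum_range_add_sum_Ico g (by omega : n + 1 ≤ N + 1), add_sub_cancel_left]
  -- termwise bound on `n < m ≤ N`
  have hterm : ∀ m ∈ Finset.Ico (n + 1) (N + 1), ‖g m‖ ≤ (n : ℝ) ^ (-s.re) := by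
    intro m hm
    rw [Finset.mem_Ico] at hm
    have hm0 : 0 < m := by omega
    have hm' : (n : ℝ) ≤ m := by exact_mod_cast (by omega : n ≤ m)
    simp only [hg, norm_mul, norm_div, Complex.norm_intCast, Complex.norm_real, Real.norm_eq_abs,
      Complex.norm_natCast_cpow_of_pos hm0]
    have hμ : |(ArithmeticFunction.moebius m : ℝ)| ≤ 1 := by
      exact_mod_cast ArithmeticFunction.abs_moebius_le_one
    have hφ : |phi h (m / n)| ≤ 1 := abs_phi_le_one h _
    have hms : (n : ℝ) ^ s.re ≤ (m : ℝ) ^ s.re := Real.rpow_le_rpow hn'.le hm' hs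
    have hnpow : 0 < (n : ℝ) ^ s.re := Real.rpow_pos_of_pos hn' _
    calc |(ArithmeticFunction.moebius m : ℝ)| / (m : ℝ) ^ s.re * |phi h (m / n)|
        ≤ 1 / (n : ℝ) ^ s.re * 1 :=
          mul_le_mul (div_le_div₀ zero_le_one hμ hnpow hms) hφ (abs_nonneg _) (by positivity)
      _ = (n : ℝ) ^ (-s.re) := by rw [mul_one, Real.rpow_neg hn'.le, one_div]
  calc ‖∑ m ∈ Finset.Ico (n + 1) (N + 1), g m‖
      ≤ ∑ m ∈ Finset.Ico (n + 1) (N + 1), ‖g m‖ := norm_sum_le _ _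
    _ ≤ ∑ m ∈ Finset.Ico (n + 1) (N + 1), (n : ℝ) ^ (-s.re) := Finset.sum_le_sum hterm
    _ = ((N : ℝ) - n) * (n : ℝ) ^ (-s.re) := by
        rw [Finset.sum_const, Nat.card_Ico, nsmul_eq_mul]
        rw [show N + 1 - (n + 1) = N - n by omega, Nat.cast_sub hnN]
    _ ≤ (n : ℝ) * h * (n : ℝ) ^ (-s.re) := by
        refine mul_le_mul_of_nonneg_right ?_ (Real.rpow_nonneg hn'.le _)
        have : (n : ℝ) * (1 + h) = n + n * h := by ring
        linarith


/-! ### The contour shift: the smoothed shifted Möbius sum approximates `ζinv(s)` -/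

/-- **Key estimate (the contour shift of Balazard–Saias, smoothed form).** Assume
quasi-RH(`α`) with `1/2 ≤ α < 1`, let `δ > 0`, `0 < ε₁ ≤ 1/4`, and let
`‖ζinv(σ'+it')‖ ≤ K(1+|t'|)^{ε₁}` for `σ' ≥ α + δ/2` (Lemme 1 of Balazard–Saias, in the tree as
`MertensBoundQuasiRH.exists_bound_zetaInv`). Then for `α + δ ≤ Re s ≤ 1`, `x ≥ 1`, `0 < h ≤ 1`,
with `η' = Re s − α − δ/2`:
`‖∑' μ(m) m^{-s} φ_h(m/x) − ζinv(s)‖ ≤ (1/2π)(36K/η') h^{-2ε₁} x^{-η'} (1+|Im s|)^{ε₁} J`,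
`J = ∫ (1+|t|)^{-1-ε₁} dt`: the smoothed Perron formula on `Re w = 2`
(`integral_vertical_two_eq_tsum_shift`), the shift to `Re w = -η'` (i.e. `Re(s+w) = α + δ/2`)
past the simple pole of `Φ_h(w) x^w ζinv(s+w)` at `w = 0` with residue `ζinv(s)`
(`integral_vertical_sub_eq_of_tendsto`), and the bound `norm_fInt_div_left_le` on the new line.
[cite: BalazardSaias1998, Lemme 2 (proof, pp. 315–316); BaezDuarte2003, Lemma 2.1] -/
theorem norm_tsum_phi_sub_zetaInv_le {α : ℝ} (hQ : QuasiRiemannHypothesis α) (hα : 1 / 2 ≤ α)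
    {δ : ℝ} (hδ : 0 < δ) {ε₁ : ℝ} (hε₁ : 0 < ε₁) (hε₁1 : ε₁ ≤ 1 / 4) {K : ℝ}
    (hK0 : 0 ≤ K)
    (hK : ∀ σ' t' : ℝ, α + δ / 2 ≤ σ' → ‖zetaInv (σ' + t' * I)‖ ≤ K * (1 + |t'|) ^ ε₁)
    {s : ℂ} (hs1 : α + δ ≤ s.re) (hs2 : s.re ≤ 1) {x : ℝ} (hx : 1 ≤ x) {h : ℝ} (hh : 0 < h)
    (hh1 : h ≤ 1) :
    ‖(∑' m : ℕ, (ArithmeticFunction.moebius m : ℂ) / (m : ℂ) ^ s * (phi h (m / x) : ℂ)) -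
        zetaInv s‖ ≤
      1 / (2 * π) * ((36 * K / (s.re - α - δ / 2) * h ^ (-(2 * ε₁)) *
        x ^ (-(s.re - α - δ / 2)) * (1 + |s.im|) ^ ε₁) * ∫ t : ℝ, (1 + ‖t‖) ^ (-(1 + ε₁))) := by
  set η' : ℝ := s.re - α - δ / 2 with hη'
  have hη'0 : 0 < η' := by rw [hη']; linarith
  have hη'1 : η' ≤ 1 / 2 := by rw [hη']; linarith
  have hx0 : 0 < x := by linarith
  have hsre : 0 ≤ s.re := by linarith
  have hsσ₁ : α + δ / 2 ≤ s.re + -η' := by rw [hη']; linarith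
  set f : ℂ → ℂ := fun w => ((((1 + h : ℝ)) : ℂ) ^ (w + 1) - 1) / (h * (w + 1)) * (x : ℂ) ^ w *
    zetaInv (s + w) with hfdef
  have hf : ∀ w, f w = ((((1 + h : ℝ)) : ℂ) ^ (w + 1) - 1) / (h * (w + 1)) * (x : ℂ) ^ w *
      zetaInv (s + w) := fun _ => rfl
  set A : ℂ := ∑' m : ℕ, (ArithmeticFunction.moebius m : ℂ) / (m : ℂ) ^ s * (phi h (m / x) : ℂ)
    with hA
  set C₀ : ℝ := 36 * K / η' * h ^ (-(2 * ε₁)) * x ^ (-η') * (1 + |s.im|) ^ ε₁ with hC₀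
  have hC₀0 : 0 ≤ C₀ := by rw [hC₀]; positivity
  -- Step 1: the smoothed Perron formula on `Re w = 2`, in the form `∫ f(2+it)/(2+it) = 2πA`
  have h2 : ((2 : ℝ) : ℂ) = 2 := by norm_num
  have hPerron : ∫ t : ℝ, f ((2 : ℝ) + t * I) / ((2 : ℝ) + t * I) = 2 * π * A := by
    have key := integral_vertical_two_eq_tsum_shift (Phi h) (fun y => (phi h y : ℂ))
      (integrable_Phi_vertical hh hh1 two_pos le_rfl)
      (fun y hy => mellinInv_Phi hh hh1 two_pos le_rfl hy) hx0 hsre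
    rw [← hA] at key
    rw [← key]
    refine integral_congr_ae (Eventually.of_forall fun t => ?_)
    have hne : s + (2 + t * I) ≠ 1 := by
      intro h0; have := congrArg Complex.re h0; simp at this; linarith
    simp only [h2]
    rw [← Phi_mul_eq_fInt_div hf, zetaInv_of_ne_one hne]
  -- Step 2: the line shift past the pole at `w = 0`
  have hfd : DifferentiableOn ℂ f (Icc (-η') 2 ×ℂ univ) := by
    refine (differentiableOn_fInt hQ hh hx0 hf).mono fun w hw => ?_
    rw [mem_reProdIm] at hw
    exact ⟨by linarith [hw.1.1], by linarith [hw.1.1]⟩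
  have hfinL : (Module.finrank ℝ ℝ : ℝ) < 1 + ε₁ := by simp; linarith
  have hfinR : (Module.finrank ℝ ℝ : ℝ) < 2 - ε₁ := by simp; linarith
  have hleft : ∀ t : ℝ, ‖f ((-η' : ℝ) + t * I) / ((-η' : ℝ) + t * I)‖ ≤
      C₀ * (1 + ‖t‖) ^ (-(1 + ε₁)) := fun t =>
    norm_fInt_div_left_le hh hh1 hx0 hK0 hε₁.le hε₁1 hK hf hη'0 hη'1 hsσ₁ t
  have hFa : Integrable fun t : ℝ => f ((-η' : ℝ) + t * I) / ((-η' : ℝ) + t * I) := by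
    refine Integrable.mono' ((integrable_one_add_norm hfinL).const_mul C₀)
      (continuous_fInt_div_vertical hQ hh hx0 hf (u := -η') (by linarith) (by linarith)
        (by linarith)).aestronglyMeasurable (Eventually.of_forall hleft)
  have hFb : Integrable fun t : ℝ => f ((2 : ℝ) + t * I) / ((2 : ℝ) + t * I) := by
    refine Integrable.mono' ((integrable_one_add_norm hfinR).const_mul
      (18 * x ^ 2 * K * (1 + |s.im|) ^ ε₁ / h))
      (continuous_fInt_div_vertical hQ hh hx0 hf (u := 2) (by norm_num) (by linarith)
        (by norm_num)).aestronglyMeasurable (Eventually.of_forall fun t => ?_)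
    exact norm_fInt_div_two_le hh hh1 hx hK0 hε₁.le hK hf (by linarith) t
  have hdecay : ∀ ε0 : ℝ, 0 < ε0 → ∃ T₀ : ℝ, ∀ σ' ∈ Icc (-η') 2, ∀ T : ℝ, T₀ ≤ |T| →
      ‖f (σ' + T * I) / (σ' + T * I)‖ ≤ ε0 := by
    intro ε0 hε0
    set B : ℝ := 18 * x ^ 2 * K * (1 + |s.im|) ^ ε₁ with hB
    have hB0 : 0 ≤ B := by rw [hB]; positivity
    refine ⟨max 1 (B / (h * ε0)), fun σ' hσ' T hT => ?_⟩
    have hT1 : 1 ≤ |T| := le_of_max_le_left hT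
    have hT2 : B / (h * ε0) ≤ |T| := le_of_max_le_right hT
    have hTpos : 0 < |T| := by linarith
    have hbd := norm_fInt_div_horizontal_le hh hh1 hx hK0 hε₁.le (by linarith) hK hf
      (u := σ') (by linarith [hσ'.1]) (by linarith [hσ'.1]) hσ'.2 hT1
    refine hbd.trans ?_
    rw [← hB, div_le_iff₀ (by positivity)]
    rw [div_le_iff₀ (by positivity)] at hT2
    nlinarith
  have hshift := integral_vertical_sub_eq_of_tendsto f (a := -η') (b := 2) (by linarith)
    two_pos hfd hFa hFb hdecay
  rw [hPerron, fInt_zero hh.ne' hf] at hshift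
  -- Step 3: `A - ζinv s = (1/2π) ∫_{Re w = -η'} f(w)/w`
  set E : ℂ := ∫ t : ℝ, f ((-η' : ℝ) + t * I) / ((-η' : ℝ) + t * I) with hE
  have hAE : A - zetaInv s = (1 / (2 * π) : ℂ) * E := by
    have hπ : (2 * π : ℂ) ≠ 0 := by exact_mod_cast (by positivity : (2 * π : ℝ) ≠ 0)
    have : (2 * π : ℂ) * (A - zetaInv s) = E := by rw [mul_sub, ← hshift]; ring
    rw [← this]
    field_simp
  have hEle : ‖E‖ ≤ C₀ * ∫ t : ℝ, (1 + ‖t‖) ^ (-(1 + ε₁)) := by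
    rw [← integral_const_mul]
    exact norm_integral_le_of_norm_le ((integrable_one_add_norm hfinL).const_mul C₀)
      (Eventually.of_forall hleft)
  rw [hAE, norm_mul, show ‖(1 / (2 * π) : ℂ)‖ = 1 / (2 * π) by
    rw [show (1 / (2 * π) : ℂ) = ((1 / (2 * π) : ℝ) : ℂ) by push_cast; rfl, Complex.norm_real,
      Real.norm_eq_abs, abs_of_pos (by positivity)]]
  gcongr

end MoebiusSumApprox

/-! ### Discharge of `baezDuarte_moebiusSum_approx` -/

open MertensBoundRH MoebiusSumApprox in
/-- **Báez-Duarte's Lemma 2.1 = Balazard–Saias, *Notes sur la fonction ζ de Riemann, 1*,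
Lemme 2** (discharge of the named fact `baezDuarte_moebiusSum_approx`): if `1/2 ≤ α < 1`,
`δ, ε > 0` and `ζ(s) ≠ 0` for `Re s > α`, there is `C` with
`|∑_{a ≤ n} μ(a) a^{-s} − 1/ζ(s)| ≤ C n^{-δ/3} (1+|τ|)^ε` for all `n ≥ 2`, `α + δ ≤ Re s ≤ 1`,
`s ≠ 1`. Proof (the printed one, Balazard–Saias pp. 315–316, with the truncated Perron formula
replaced by the smoothed kernel `φ_h` of `MertensBoundRH`, which makes every integral absolutely
convergent): with `h = n^{-(1/2 − 2δ/3)}` and `ε₁ = min(ε, δ/6, 1/4)`, the key estimate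
`norm_tsum_phi_sub_zetaInv_le` (Perron on `Re w = 2`, shift to `Re(s+w) = α + δ/2` past the pole
at `w = 0` with residue `ζinv(s) = 1/ζ(s)`, Lemme 1 = `MertensBoundQuasiRH.exists_bound_zetaInv` on
the new line) gives `O(n^{-δ/2} h^{-2ε₁} (1+|τ|)^{ε₁}) = O(n^{-δ/3}(1+|τ|)^ε)`, and removing the
smoothing costs `≤ nh · n^{-Re s} ≤ n^{-δ/3}` (`norm_tsum_phi_sub_sum_le`, using `α ≥ 1/2`). For
`α + δ > 1` the statement is vacuous.
[cite: BaezDuarte2003, Lemma 2.1; BalazardSaias1998, Lemme 2, pp. 315–316] -/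
theorem baezDuarte_moebiusSum_approx_holds : baezDuarte_moebiusSum_approx := by
  intro α δ ε hα hα1 hδ hε hzero
  have hQ : QuasiRiemannHypothesis α :=
    (forall_riemannZeta_ne_zero_iff_quasiRiemannHypothesis α).1 hzero
  -- the vacuous case `α + δ > 1`
  by_cases hδ1 : α + δ ≤ 1
  swap
  · exact ⟨0, fun n s _ hs1 hs2 _ => absurd (hs1.trans hs2) hδ1⟩
  have hδ2 : δ ≤ 1 / 2 := by linarith
  -- parameters
  set ε₁ : ℝ := min ε (min (δ / 6) (1 / 4)) with hε₁def
  have hε₁0 : 0 < ε₁ := lt_min hε (lt_min (by linarith) (by norm_num))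
  have hε₁ε : ε₁ ≤ ε := min_le_left _ _
  have hε₁δ : ε₁ ≤ δ / 6 := (min_le_right _ _).trans (min_le_left _ _)
  have hε₁4 : ε₁ ≤ 1 / 4 := (min_le_right _ _).trans (min_le_right _ _)
  obtain ⟨K, hK0, hK⟩ :=
    MertensBoundQuasiRH.exists_bound_zetaInv hQ hα hα1 (σ₀ := α + δ / 2) (by linarith) hε₁0
  set J : ℝ := ∫ t : ℝ, (1 + ‖t‖) ^ (-(1 + ε₁)) with hJ
  have hJ0 : 0 ≤ J := integral_nonneg fun t => by positivity
  set a₀ : ℝ := 1 / 2 - 2 * δ / 3 with ha₀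
  have ha₀0 : 0 < a₀ := by rw [ha₀]; linarith
  have ha₀1 : a₀ ≤ 1 / 2 := by rw [ha₀]; linarith
  set C₁ : ℝ := 1 / (2 * π) * (72 * K / δ * J) with hC₁
  have hC₁0 : 0 ≤ C₁ := by rw [hC₁]; positivity
  refine ⟨C₁ + 1, fun n s hn hs1 hs2 hs3 => ?_⟩
  have hn0 : (0 : ℝ) < n := by exact_mod_cast (by omega : 0 < n)
  have hn1 : (1 : ℝ) ≤ n := by exact_mod_cast (by omega : 1 ≤ n)
  have hsre : 0 ≤ s.re := by linarith
  -- the smoothing parameter `h = n^{-a₀}`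
  set h : ℝ := (n : ℝ) ^ (-a₀) with hhdef
  have hh : 0 < h := Real.rpow_pos_of_pos hn0 _
  have hh1 : h ≤ 1 := Real.rpow_le_one_of_one_le_of_nonpos hn1 (by linarith)
  set η' : ℝ := s.re - α - δ / 2 with hη'
  have hη'0 : δ / 2 ≤ η' := by rw [hη']; linarith
  have hη'pos : 0 < η' := by linarith
  set A : ℂ := ∑' m : ℕ, (ArithmeticFunction.moebius m : ℂ) / (m : ℂ) ^ s * (phi h (m / n) : ℂ)
    with hA
  set S : ℂ := ∑ a ∈ Finset.Icc 1 n, (ArithmeticFunction.moebius a : ℂ) / (a : ℂ) ^ s with hS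
  -- the two errors
  have hmain := norm_tsum_phi_sub_zetaInv_le hQ hα hδ hε₁0 hε₁4 hK0.le hK hs1 hs2 hn1 hh hh1
  rw [← hA, ← hη'] at hmain
  have hdes := norm_tsum_phi_sub_sum_le hh (n := n) (by omega) hsre
  rw [← hA, ← hS] at hdes
  -- exponent bookkeeping
  have hpow1 : (n : ℝ) * h * (n : ℝ) ^ (-s.re) ≤ (n : ℝ) ^ (-δ / 3) := by
    have e : (n : ℝ) * h * (n : ℝ) ^ (-s.re) = (n : ℝ) ^ (1 + -a₀ + -s.re) := by
      rw [hhdef, Real.rpow_add hn0, Real.rpow_add hn0, Real.rpow_one]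
    rw [e]
    refine Real.rpow_le_rpow_of_exponent_le hn1 ?_
    rw [ha₀]; linarith
  have hpow2 : h ^ (-(2 * ε₁)) * (n : ℝ) ^ (-η') ≤ (n : ℝ) ^ (-δ / 3) := by
    rw [hhdef, ← Real.rpow_mul hn0.le, ← Real.rpow_add hn0]
    refine Real.rpow_le_rpow_of_exponent_le hn1 ?_
    have : -a₀ * -(2 * ε₁) = 2 * a₀ * ε₁ := by ring
    rw [this]
    nlinarith
  have hτ1 : 1 ≤ (1 + |s.im|) ^ ε := Real.one_le_rpow (by linarith [abs_nonneg s.im]) hε.le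
  have hτ2 : (1 + |s.im|) ^ ε₁ ≤ (1 + |s.im|) ^ ε :=
    Real.rpow_le_rpow_of_exponent_le (by linarith [abs_nonneg s.im]) hε₁ε
  have hKη : 36 * K / η' ≤ 72 * K / δ := by
    rw [div_le_div_iff₀ hη'pos hδ]
    nlinarith
  have hnpow : 0 ≤ (n : ℝ) ^ (-δ / 3) := Real.rpow_nonneg hn0.le _
  -- `‖A - ζinv s‖ ≤ C₁ n^{-δ/3} (1+|τ|)^ε`
  have hmain' : ‖A - zetaInv s‖ ≤ C₁ * (n : ℝ) ^ (-δ / 3) * (1 + |s.im|) ^ ε := by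
    refine hmain.trans ?_
    have hX : 0 ≤ (1 + |s.im|) ^ ε₁ := by positivity
    calc 1 / (2 * π) * (36 * K / η' * h ^ (-(2 * ε₁)) * (n : ℝ) ^ (-η') * (1 + |s.im|) ^ ε₁ * J)
        = 1 / (2 * π) * (36 * K / η') * J * (h ^ (-(2 * ε₁)) * (n : ℝ) ^ (-η')) *
            (1 + |s.im|) ^ ε₁ := by ring
      _ ≤ 1 / (2 * π) * (72 * K / δ) * J * (n : ℝ) ^ (-δ / 3) * (1 + |s.im|) ^ ε := by
          gcongr
      _ = C₁ * (n : ℝ) ^ (-δ / 3) * (1 + |s.im|) ^ ε := by rw [hC₁]; ring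
  -- `‖A - S‖ ≤ n^{-δ/3}`
  have hdes' : ‖A - S‖ ≤ (n : ℝ) ^ (-δ / 3) * (1 + |s.im|) ^ ε := by
    calc ‖A - S‖ ≤ (n : ℝ) * h * (n : ℝ) ^ (-s.re) := hdes
      _ ≤ (n : ℝ) ^ (-δ / 3) := hpow1
      _ = (n : ℝ) ^ (-δ / 3) * 1 := (mul_one _).symm
      _ ≤ (n : ℝ) ^ (-δ / 3) * (1 + |s.im|) ^ ε := by gcongr
  -- conclusion
  have hζ : 1 / riemannZeta s = zetaInv s := by rw [zetaInv_of_ne_one hs3, one_div]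
  rw [hζ]
  calc ‖S - zetaInv s‖ = ‖(A - zetaInv s) - (A - S)‖ := by ring_nf
    _ ≤ ‖A - zetaInv s‖ + ‖A - S‖ := norm_sub_le _ _
    _ ≤ C₁ * (n : ℝ) ^ (-δ / 3) * (1 + |s.im|) ^ ε + (n : ℝ) ^ (-δ / 3) * (1 + |s.im|) ^ ε :=
        add_le_add hmain' hdes'
    _ = (C₁ + 1) * (n : ℝ) ^ (-δ / 3) * (1 + |s.im|) ^ ε := by ring

end Literature.NumberTheory.LFunctions

end
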